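import Summits.BirchSwinnertonDyer.BirchSwinnertonDyer.Theorems.CMKolyvaginAtInertTwoImageToolkitAtTwo
import Summits.BirchSwinnertonDyer.BirchSwinnertonDyer.Theorems.CMKolyvaginAtInertTwoNonSquareConditionsAtTwo
import Literature.NumberTheory.EllipticCurves.TwoAdicImageSurjectivityModTwoProofs
import Literature.NumberTheory.QuadraticFields.ThreeTorsion
import Literature.NumberTheory.QuadraticFields.SquareRootGenerator
import HarnessLib

/-!
# Route `CMKolyvaginAtInertTwo`, crux `CMKolyvaginExactAtInertTwo` (stmt-BirchSwinnertonDyer-24277):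
# `Δ_E ∉ K²` ⟹ some element of `Γ_K` acts on `E[2]` as a TRANSPOSITION (`ρ̄(Γ_K) = S₃`) — the
# displayed hypothesis of the commutant lemma `KolyvaginImageTwo.eq_zero_or_eq_id_of_commute_two`,
# discharged on the habitat H₂

Seat `bsd-line-cmk2-p1` g3 (cell `bsd-print-cf2`); helper (`--supports stmt-BirchSwinnertonDyer-24277`;
also gk2's 22137). THEOREMS ONLY: no definition, no named fact, no `sorry`; no item is closed; BSD is
not proved by any of this.

* §1 (any field `F` of characteristic `0`, any elliptic `W/F`, `Γ_F` acting on `E(F̄)[2]`):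
  `exists_transposition_of_not_isSquare_Δ` — **if `Δ(W)` is not a square in `F`, some `g ∈ Γ_F`
  fixes a non-zero `2`-torsion point and moves another** (an element of `Aut E[2] ≅ S₃` with a
  non-zero fixed point is `1` or a transposition; if no `g` were a transposition, every `g` would
  act as `1` or as a `3`-cycle on the roots `e₁, e₂, e₃` of the `2`-division cubic, hence fix
  `δ = (e₁−e₂)(e₁−e₃)(e₂−e₃)`, so `δ ∈ F` by Galois descent in `F̄`
  (`InfiniteGalois.mem_range_algebraMap_iff_fixed`) and `16Δ = (16δ)²`... i.e. `Δ ∈ F²`).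
  Ingredients: the root ↦ `2`-torsion point dictionary over a general base (g2's
  `exists_point_two_smul_eq_zero_of_isRoot`, restated for `F`), `Γ_F` permutes the roots, a
  fixed-point-free `g` is a `3`-cycle on them (even), Mathlib `Cubic.discr_eq_prod_three_roots`.
* §2 (quadratic `K`): `isSquare_or_isSquare_mul_of_isSquare_algebraMap` — a rational square in
  `K = ℚ(√d_K)` lies in `ℚ² ∪ d_K ℚ²`; hence on H₂ (`CMInert W 2`, `ρ̄₂` onto, `K` Heegner for
  `N_E`): `Δ_E ∉ K²` (`not_isSquare_algebraMap_Δ_of_cmInert_two_of_heegner`: `Δ ∉ ℚ²` by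
  surjectivity, `d_K Δ ∉ ℚ²` by p594125), so **`exists_transposition_of_cmInert_two_of_heegner`**
  and the hypothesis-free commutant statement
  **`eq_zero_or_eq_id_of_commute_two_of_cmInert_two_of_heegner`**: on H₂, for every admissible
  Heegner field `K`, a `Γ_K`-equivariant additive endomorphism of `E(K̄)[2]` is `0` or `1`.

References: [GrossLMS1991] §9 (proof of Prop. 9.3); [LawsonWuthrich2016] §2;
[DokchitserDokchitserMathZ2012] Thm. 1 (`ℚ(E[2]) ⊇ ℚ(√Δ)`); [SilvermanAEC2009] III.1.
-/

-- single-conjunct summit: `Summit.BirchSwinnertonDyer.BirchSwinnertonDyer.…` repeats the name by design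
set_option linter.dupNamespace false
set_option autoImplicit false

noncomputable section

open scoped Classical

namespace Summit.BirchSwinnertonDyer.BirchSwinnertonDyer.Theorems.KolyvaginImageTwo

open Polynomial WeierstrassCurve Field
open Literature.NumberTheory.EllipticCurves Literature.NumberTheory.GaloisRepresentations

universe u

/-! ## §1 Over any field of characteristic zero -/

section General

variable {F : Type u} [Field F] [CharZero F] (W : WeierstrassCurve F) [W.IsElliptic]

omit [CharZero F] [W.IsElliptic] in
/-- The `2`-division cubic commutes with base change to `F̄`, as a `Cubic`. [folklore] -/
private theorem twoTorsionPolynomial_baseChange_eq_map :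
    (W.baseChange (AlgebraicClosure F)).twoTorsionPolynomial =
      Cubic.map (algebraMap F (AlgebraicClosure F)) W.twoTorsionPolynomial := by
  simp [baseChange, twoTorsionPolynomial, Cubic.map, map_b₂, map_b₄, map_b₆, map_ofNat]

/-- **Root ↦ point of order `2` over a general base** (g2's
`KolyvaginEigenTwo.exists_point_two_smul_eq_zero_of_isRoot` with `ℚ` replaced by `F`): a root
`e ∈ F̄` of `4x³ + b₂x² + 2b₄x + b₆` is the abscissa of the `2`-torsion point
`(e, −(a₁e + a₃)/2)`. [cite: SilvermanAEC2009, III.1 and III.2.3(d)] -/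
theorem exists_point_two_smul_eq_zero_of_isRoot' {e : AlgebraicClosure F}
    (he : (W.baseChange (AlgebraicClosure F)).twoTorsionPolynomial.toPoly.IsRoot e) :
    ∃ (h : (W.baseChange (AlgebraicClosure F)).toAffine.Nonsingular e
        (-((W.baseChange (AlgebraicClosure F)).a₁ * e + (W.baseChange (AlgebraicClosure F)).a₃) / 2)),
      (2 : ℤ) • (Affine.Point.some e _ h : geomPoints W) = 0 := by
  haveI : (W.baseChange (AlgebraicClosure F)).IsElliptic := by rw [baseChange]; infer_instance
  set V := W.baseChange (AlgebraicClosure F) with hV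
  have hroot : 4 * e ^ 3 + V.b₂ * e ^ 2 + 2 * V.b₄ * e + V.b₆ = 0 := by
    have := he
    simp only [twoTorsionPolynomial, Cubic.toPoly, IsRoot.def, eval_add, eval_mul, eval_C, eval_pow,
      eval_X] at this
    linear_combination this
  have hb₂ : V.b₂ = V.a₁ ^ 2 + 4 * V.a₂ := rfl
  have hb₄ : V.b₄ = 2 * V.a₄ + V.a₁ * V.a₃ := rfl
  have hb₆ : V.b₆ = V.a₃ ^ 2 + 4 * V.a₆ := rfl
  rw [hb₂, hb₄, hb₆] at hroot
  have hns : V.toAffine.Nonsingular e (-(V.a₁ * e + V.a₃) / 2) := by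
    rw [← Affine.equation_iff_nonsingular, Affine.equation_iff]
    linear_combination (-(1 : AlgebraicClosure F) / 4) * hroot
  refine ⟨hns, ?_⟩
  have hneg : -(Affine.Point.some _ _ hns : geomPoints W) = Affine.Point.some _ _ hns := by
    change -(Affine.Point.some _ _ hns : V.toAffine.Point) = Affine.Point.some _ _ hns
    rw [Affine.Point.neg_some]
    congr 1
    change -(-(V.a₁ * e + V.a₃) / 2) - V.a₁ * e - V.a₃ = _
    ring
  have h0 := neg_add_cancel (Affine.Point.some _ _ hns : geomPoints W)
  rw [hneg] at h0
  rwa [two_zsmul]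

omit [W.IsElliptic] in
/-- **`Γ_F` permutes the roots of the `2`-division cubic in `F̄`.** [folklore] -/
theorem smul_mem_roots (σ : absoluteGaloisGroup F) {e : AlgebraicClosure F}
    (he : e ∈ (Cubic.map (algebraMap F (AlgebraicClosure F)) W.twoTorsionPolynomial).roots) :
    σ • e ∈ (Cubic.map (algebraMap F (AlgebraicClosure F)) W.twoTorsionPolynomial).roots := by
  have ha : W.twoTorsionPolynomial.a ≠ 0 := by change (4 : F) ≠ 0; norm_num
  have ha' : (Cubic.map (algebraMap F (AlgebraicClosure F)) W.twoTorsionPolynomial).a ≠ 0 := by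
    change algebraMap F (AlgebraicClosure F) W.twoTorsionPolynomial.a ≠ 0
    exact (_root_.map_ne_zero _).mpr ha
  have hne0 := Cubic.ne_zero_of_a_ne_zero ha'
  have he' := (mem_roots hne0).mp he
  refine (mem_roots hne0).mpr ?_
  rw [Cubic.map_toPoly, IsRoot.def, eval_map_algebraMap] at he' ⊢
  rw [absoluteGaloisGroup.smul_def,
    show (absoluteGaloisGroup.toAlgEquiv F σ) e =
      ((absoluteGaloisGroup.toAlgEquiv F σ : AlgebraicClosure F →ₐ[F] AlgebraicClosure F)) e from rfl,
    Polynomial.aeval_algHom_apply, he', map_zero]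

/-- **An element of `Γ_F` fixing a root fixes the `2`-torsion point above it** (the ordinate
`−(a₁e + a₃)/2` is rational in `e`). Hence a FIXED-POINT-FREE `σ` moves every root. [folklore] -/
theorem smul_root_ne_of_fixedPointFree {σ : absoluteGaloisGroup F}
    (hσ : ∀ P : geomTorsion W ((2 : ℕ) : ℤ), σ • P = P → P = 0) {e : AlgebraicClosure F}
    (he : e ∈ (Cubic.map (algebraMap F (AlgebraicClosure F)) W.twoTorsionPolynomial).roots) :
    σ • e ≠ e := by
  intro hfix
  have ha : W.twoTorsionPolynomial.a ≠ 0 := by change (4 : F) ≠ 0; norm_num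
  have ha' : (Cubic.map (algebraMap F (AlgebraicClosure F)) W.twoTorsionPolynomial).a ≠ 0 := by
    change algebraMap F (AlgebraicClosure F) W.twoTorsionPolynomial.a ≠ 0
    exact (_root_.map_ne_zero _).mpr ha
  have hroot : (Cubic.map (algebraMap F (AlgebraicClosure F)) W.twoTorsionPolynomial).toPoly.IsRoot e :=
    (mem_roots (Cubic.ne_zero_of_a_ne_zero ha')).mp he
  rw [← twoTorsionPolynomial_baseChange_eq_map] at hroot
  obtain ⟨hns, h2⟩ := exists_point_two_smul_eq_zero_of_isRoot' W hroot
  set P : geomPoints W := Affine.Point.some e _ hns with hP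
  have hPmem : P ∈ geomTorsion W ((2 : ℕ) : ℤ) := by
    rw [mem_geomTorsion_iff, Nat.cast_ofNat]; exact h2
  -- `σ • P = P`
  have hσP : σ • (⟨P, hPmem⟩ : geomTorsion W ((2 : ℕ) : ℤ)) = ⟨P, hPmem⟩ := by
    apply Subtype.ext
    change σ • P = P
    have hmap : σ • P = Affine.Point.map ((absoluteGaloisGroup.toAlgEquiv F σ).toAlgHom) P := rfl
    rw [hmap, hP, Affine.Point.map_some]
    set f : AlgebraicClosure F →ₐ[F] AlgebraicClosure F :=
      ((absoluteGaloisGroup.toAlgEquiv F σ : AlgebraicClosure F →ₐ[F] AlgebraicClosure F)) with hf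
    have hfe : f e = e := hfix
    have hfa₁ : f (W.baseChange (AlgebraicClosure F)).a₁ = (W.baseChange (AlgebraicClosure F)).a₁ :=
      f.commutes W.a₁
    have hfa₃ : f (W.baseChange (AlgebraicClosure F)).a₃ = (W.baseChange (AlgebraicClosure F)).a₃ :=
      f.commutes W.a₃
    refine Affine.Point.some_eq_some_of_eq hfe ?_
    rw [map_div₀, map_neg, map_add, map_mul, hfe, hfa₁, hfa₃, map_ofNat]
  have hfixed := hσ _ hσP
  have hP0 : P ≠ 0 := by rw [hP]; exact Affine.Point.some_ne_zero _
  exact hP0 (congrArg Subtype.val hfixed)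

/-- **An element of `Γ_F` fixing `E[2]` pointwise fixes every root of the `2`-division cubic.**
[cite: SilvermanAEC2009, III.1] -/
theorem smul_root_eq_of_forall_smul_eq {σ : absoluteGaloisGroup F}
    (hσ : ∀ P : geomTorsion W ((2 : ℕ) : ℤ), σ • P = P) {e : AlgebraicClosure F}
    (he : e ∈ (Cubic.map (algebraMap F (AlgebraicClosure F)) W.twoTorsionPolynomial).roots) :
    σ • e = e := by
  have ha : W.twoTorsionPolynomial.a ≠ 0 := by change (4 : F) ≠ 0; norm_num
  have ha' : (Cubic.map (algebraMap F (AlgebraicClosure F)) W.twoTorsionPolynomial).a ≠ 0 := by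
    change algebraMap F (AlgebraicClosure F) W.twoTorsionPolynomial.a ≠ 0
    exact (_root_.map_ne_zero _).mpr ha
  have hroot : (Cubic.map (algebraMap F (AlgebraicClosure F)) W.twoTorsionPolynomial).toPoly.IsRoot e :=
    (mem_roots (Cubic.ne_zero_of_a_ne_zero ha')).mp he
  rw [← twoTorsionPolynomial_baseChange_eq_map] at hroot
  obtain ⟨hns, h2⟩ := exists_point_two_smul_eq_zero_of_isRoot' W hroot
  set P : geomPoints W := Affine.Point.some e _ hns with hP
  have hPmem : P ∈ geomTorsion W ((2 : ℕ) : ℤ) := by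
    rw [mem_geomTorsion_iff, Nat.cast_ofNat]; exact h2
  have hv := hσ ⟨P, hPmem⟩
  have hv' : σ • P = P := congrArg Subtype.val hv
  have hmap : σ • P = Affine.Point.map ((absoluteGaloisGroup.toAlgEquiv F σ).toAlgHom) P := rfl
  rw [hmap, hP, Affine.Point.map_some] at hv'
  injection hv' with hx hy

/-- **A fixed-point-free element of `Γ_F` is a `3`-cycle on the roots, hence fixes
`δ = (e₁−e₂)(e₁−e₃)(e₂−e₃)`** (it permutes the three distinct roots without fixed point; both
derangements of three letters are even). [folklore] -/
theorem smul_prod_sub_eq_of_fixedPointFree {σ : absoluteGaloisGroup F}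
    (hσ : ∀ P : geomTorsion W ((2 : ℕ) : ℤ), σ • P = P → P = 0) {e₁ e₂ e₃ : AlgebraicClosure F}
    (h3 : (Cubic.map (algebraMap F (AlgebraicClosure F)) W.twoTorsionPolynomial).roots = {e₁, e₂, e₃})
    (h12 : e₁ ≠ e₂) (h13 : e₁ ≠ e₃) (h23 : e₂ ≠ e₃) :
    σ • ((e₁ - e₂) * (e₁ - e₃) * (e₂ - e₃)) = (e₁ - e₂) * (e₁ - e₃) * (e₂ - e₃) := by
  have hmem : ∀ {e}, e ∈ (Cubic.map (algebraMap F (AlgebraicClosure F)) W.twoTorsionPolynomial).roots ↔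
      e = e₁ ∨ e = e₂ ∨ e = e₃ := fun {e} ↦ by rw [h3]; simp
  have hr1 : e₁ ∈ (Cubic.map (algebraMap F (AlgebraicClosure F)) W.twoTorsionPolynomial).roots :=
    hmem.mpr (Or.inl rfl)
  have hr2 : e₂ ∈ (Cubic.map (algebraMap F (AlgebraicClosure F)) W.twoTorsionPolynomial).roots :=
    hmem.mpr (Or.inr (Or.inl rfl))
  have hr3 : e₃ ∈ (Cubic.map (algebraMap F (AlgebraicClosure F)) W.twoTorsionPolynomial).roots :=
    hmem.mpr (Or.inr (Or.inr rfl))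
  have hs1 := hmem.mp (smul_mem_roots W σ hr1)
  have hs2 := hmem.mp (smul_mem_roots W σ hr2)
  have hs3 := hmem.mp (smul_mem_roots W σ hr3)
  have hn1 := smul_root_ne_of_fixedPointFree W hσ hr1
  have hn2 := smul_root_ne_of_fixedPointFree W hσ hr2
  have hn3 := smul_root_ne_of_fixedPointFree W hσ hr3
  have hinj : ∀ {x y : AlgebraicClosure F}, σ • x = σ • y → x = y := fun {x y} h ↦ smul_left_cancel σ h
  rw [smul_mul', smul_mul', smul_sub, smul_sub, smul_sub]
  -- `σ e₁ ∈ {e₂, e₃}`, `σ e₂ ∈ {e₁, e₃}`, `σ e₃ ∈ {e₁, e₂}`, injective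
  rcases hs1 with h1 | h1 | h1
  · exact absurd h1 hn1
  · -- `σ e₁ = e₂`; then `σ e₂ = e₃` (not `e₂`, not `e₁` since then `σ e₃ = e₃`... ) and `σ e₃ = e₁`
    rcases hs3 with h3' | h3' | h3'
    · rcases hs2 with h2' | h2' | h2'
      · exact absurd (hinj (h3'.trans h2'.symm)) h23.symm
      · exact absurd h2' hn2
      · rw [h1, h2', h3']; ring
    · exact absurd (hinj (h1.trans h3'.symm)) h13
    · exact absurd h3' hn3
  · -- `σ e₁ = e₃`; then `σ e₃ = e₂` and `σ e₂ = e₁`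
    rcases hs2 with h2' | h2' | h2'
    · rcases hs3 with h3' | h3' | h3'
      · exact absurd (hinj (h2'.trans h3'.symm)) h23
      · rw [h1, h2', h3']; ring
      · exact absurd h3' hn3
    · exact absurd h2' hn2
    · exact absurd (hinj (h1.trans h2'.symm)) h12

/-- **`Δ(W) ∉ F²` ⟹ some `g ∈ Γ_F` acts on `E(F̄)[2]` as a transposition** (fixes a non-zero
`2`-torsion point, moves another): otherwise every `g` acts trivially or without fixed points, so
fixes `δ = (e₁−e₂)(e₁−e₃)(e₂−e₃)` (§1), and by Galois descent `δ ∈ F`, `16Δ = (16δ)²` up to the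
leading coefficient: `Δ = (4·4·δ)²/16 ∈ F²`. [cite: DokchitserDokchitserMathZ2012, Thm. 1 (ℚ(E[2]) ⊇ ℚ(√Δ))]
[cite: LawsonWuthrich2016, §2] -/
theorem exists_transposition_of_not_isSquare_Δ (hΔ : ¬ IsSquare W.Δ) :
    ∃ (g : absoluteGaloisGroup F) (u w : geomTorsion W ((2 : ℕ) : ℤ)), u ≠ 0 ∧ g • u = u ∧ g • w ≠ w := by
  by_contra hno
  push Not at hno
  -- every `g` acts trivially or without non-zero fixed points
  have hdich : ∀ g : absoluteGaloisGroup F, (∀ P : geomTorsion W ((2 : ℕ) : ℤ), g • P = P) ∨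
      (∀ P : geomTorsion W ((2 : ℕ) : ℤ), g • P = P → P = 0) := by
    intro g
    by_cases h : ∃ u : geomTorsion W ((2 : ℕ) : ℤ), u ≠ 0 ∧ g • u = u
    · obtain ⟨u, hu0, hu⟩ := h
      exact Or.inl fun P ↦ hno g u P hu0 hu
    · push Not at h
      exact Or.inr fun P hP ↦ by_contra fun hP0 ↦ h P hP0 hP
  -- the three distinct roots and `δ`
  have ha : W.twoTorsionPolynomial.a ≠ 0 := by change (4 : F) ≠ 0; norm_num
  have hsplit : (W.twoTorsionPolynomial.toPoly.map (algebraMap F (AlgebraicClosure F))).Splits :=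
    IsAlgClosed.splits _
  obtain ⟨e₁, e₂, e₃, h3⟩ := (Cubic.splits_iff_roots_eq_three ha).mp hsplit
  have hdisc := Cubic.discr_eq_prod_three_roots ha h3
  rw [twoTorsionPolynomial_discr] at hdisc
  have ha4 : W.twoTorsionPolynomial.a = 4 := rfl
  rw [ha4] at hdisc
  have hΔ0 : W.Δ ≠ 0 := by rw [← coe_Δ']; exact W.Δ'.ne_zero
  -- distinct roots (`Δ ≠ 0`)
  have hprod0 : (e₁ - e₂) * (e₁ - e₃) * (e₂ - e₃) ≠ 0 := by
    intro h0
    have : algebraMap F (AlgebraicClosure F) (16 * W.Δ) = 0 := by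
      rw [hdisc]
      have e : algebraMap F (AlgebraicClosure F) 4 * algebraMap F (AlgebraicClosure F) 4 * (e₁ - e₂) *
          (e₁ - e₃) * (e₂ - e₃) = algebraMap F (AlgebraicClosure F) 4 * algebraMap F (AlgebraicClosure F) 4 *
          ((e₁ - e₂) * (e₁ - e₃) * (e₂ - e₃)) := by ring
      rw [e, h0, mul_zero, zero_pow two_ne_zero]
    have h16 : (16 : F) * W.Δ = 0 := (map_eq_zero _).mp this
    exact hΔ0 (by simpa using h16)
  have h12 : e₁ ≠ e₂ := fun h ↦ hprod0 (by rw [h, sub_self, zero_mul, zero_mul])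
  have h13 : e₁ ≠ e₃ := fun h ↦ hprod0 (by rw [h, sub_self, mul_zero, zero_mul])
  have h23 : e₂ ≠ e₃ := fun h ↦ hprod0 (by rw [h, sub_self, mul_zero])
  set δ : AlgebraicClosure F := (e₁ - e₂) * (e₁ - e₃) * (e₂ - e₃) with hδ
  -- every `g` fixes `δ`
  have hfix : ∀ g : absoluteGaloisGroup F, g • δ = δ := by
    intro g
    rcases hdich g with h | h
    · have hmem : ∀ {e}, e = e₁ ∨ e = e₂ ∨ e = e₃ →
          e ∈ (Cubic.map (algebraMap F (AlgebraicClosure F)) W.twoTorsionPolynomial).roots :=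
        fun {e} he ↦ by rw [h3]; simpa using he
      have := smul_root_eq_of_forall_smul_eq W h (hmem (Or.inl rfl))
      have h2 := smul_root_eq_of_forall_smul_eq W h (hmem (Or.inr (Or.inl rfl)))
      have h3' := smul_root_eq_of_forall_smul_eq W h (hmem (Or.inr (Or.inr rfl)))
      simp only [hδ, smul_mul', smul_sub, this, h2, h3']
    · exact smul_prod_sub_eq_of_fixedPointFree W h h3 h12 h13 h23
  -- Galois descent: `δ ∈ F`
  haveI : IsGalois F (AlgebraicClosure F) := {}
  obtain ⟨c, hc⟩ := (InfiniteGalois.mem_range_algebraMap_iff_fixed δ).mpr fun g ↦ hfix g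
  -- `16 Δ = (16 c)²`, so `Δ = (4c)²`
  apply hΔ
  refine ⟨4 * c, ?_⟩
  have h44 : algebraMap F (AlgebraicClosure F) 4 = 4 := map_ofNat _ 4
  have : algebraMap F (AlgebraicClosure F) (16 * W.Δ) = algebraMap F (AlgebraicClosure F) ((16 * c) ^ 2) := by
    rw [hdisc, h44, map_pow, map_mul, map_ofNat, hc]; ring
  have h' : (16 : F) * W.Δ = (16 * c) ^ 2 := (algebraMap F (AlgebraicClosure F)).injective this
  linear_combination (1 / 16 : F) * h'

end General

/-! ## §2 Quadratic `K`: a rational square in `K` lies in `ℚ² ∪ d_K ℚ²`; the habitat H₂ -/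

section Quadratic

open Literature.NumberTheory.QuadraticFields

/-- **Rational squares in a quadratic field**: if `[K : ℚ] = 2` and the rational `r` is a square
in `K`, then `r ∈ ℚ²` or `d_K · r ∈ ℚ²` (`K = ℚ(γ)`, `γ² = d_K`, `(p + qγ)² = r` forces `pq = 0`).
[folklore] -/
theorem isSquare_or_isSquare_mul_of_isSquare_algebraMap (K : Type) [Field K] [NumberField K]
    (hK2 : Module.finrank ℚ K = 2) {r : ℚ} (hr : IsSquare (algebraMap ℚ K r)) :
    IsSquare r ∨ IsSquare ((NumberField.discr K : ℚ) * r) := by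
  obtain ⟨γ, hγ, hγd⟩ := Quadratic.exists_not_mem_range_sq_eq_discr (K := K) hK2
  obtain ⟨c, hc⟩ := hr
  obtain ⟨p, q, hcpq⟩ := Quadratic.exists_eq_add_mul hK2 hγ c
  have hmul := Quadratic.add_mul_mul_add_mul hγd p q p q
  rw [← hcpq, ← hc] at hmul
  have hr' : algebraMap ℚ K r = algebraMap ℚ K r + algebraMap ℚ K 0 * γ := by
    rw [map_zero, zero_mul, add_zero]
  rw [hr'] at hmul
  obtain ⟨h1, h2⟩ := Quadratic.ext_add_mul hγ hmul
  -- `h1 : r = p*p + q*q*d_K`, `h2 : 0 = p*q + q*p`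
  have hpq : p * q = 0 := by linear_combination h2.symm / 2
  rcases mul_eq_zero.mp hpq with hp | hq
  · right
    refine ⟨(NumberField.discr K : ℚ) * q, ?_⟩
    rw [h1, hp]; ring
  · left
    exact ⟨p, by rw [h1, hq]; ring⟩

variable (W : WeierstrassCurve ℚ) [W.IsElliptic]

/-- **On H₂, `Δ_E` is not a square in any admissible Heegner field `K`**: `Δ ∉ ℚ²` (`ρ̄_{W,2}` onto:
irreducible `2`-division cubic with Galois group `S₃`, tree
`DokchitserDokchitser2012.not_isSquare_Δ_of_hasSurjectiveModNGaloisRep_two`) and `d_K·Δ ∉ ℚ²`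
(the first (H2) exclusion, automatic: p594125, with `Δ < 0`). [cite: DokchitserDokchitserMathZ2012, Thm. 1] -/
theorem not_isSquare_algebraMap_Δ_of_cmInert_two_of_heegner [W.IsGloballyMinimal] (hCM : W.HasCM)
    (hin : Literature.NumberTheory.EllipticCurves.Rank1Residual.CMInert W 2)
    (hsurj : W.HasSurjectiveModNGaloisRep 2) (K : Type) [Field K] [NumberField K]
    (hK : IsImaginaryQuadratic K) (hH : SatisfiesHeegnerHypothesis (W.conductorNorm ℤ) K) :
    ¬ IsSquare (algebraMap ℚ K W.Δ) := by
  intro hsq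
  rcases isSquare_or_isSquare_mul_of_isSquare_algebraMap K hK.1 hsq with h | h
  · exact DokchitserDokchitser2012.not_isSquare_Δ_of_hasSurjectiveModNGaloisRep_two W two_ne_zero hsurj h
  · have hΔneg : W.Δ < 0 := KolyvaginEigenTwo.Δ_neg_of_cmInert_two W hCM hin hsurj
    have habs : -|W.Δ| = W.Δ := by rw [abs_of_neg hΔneg, neg_neg]
    have := KolyvaginFrobeniusTwo.not_isSquare_discr_mul_neg_abs_Δ_of_cmInert_two_of_heegner W hCM hin
      hsurj K hK hH
    rw [habs] at this
    exact this h

/-- **On H₂, `ρ̄(Γ_K) = S₃`: some `g ∈ Γ_K` acts on `E(K̄)[2]` as a transposition**, for every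
admissible Heegner field `K` (fixes a non-zero `2`-torsion point and moves another).
[cite: GrossLMS1991, §9 (𝒢 = Gal(L/K) ≅ GL₂ when K ⊄ ℚ(E_p))] -/
theorem exists_transposition_of_cmInert_two_of_heegner [W.IsGloballyMinimal] (hCM : W.HasCM)
    (hin : Literature.NumberTheory.EllipticCurves.Rank1Residual.CMInert W 2)
    (hsurj : W.HasSurjectiveModNGaloisRep 2) (K : Type) [Field K] [NumberField K]
    (hK : IsImaginaryQuadratic K) (hH : SatisfiesHeegnerHypothesis (W.conductorNorm ℤ) K) :
    ∃ (g : absoluteGaloisGroup K) (u w : geomTorsion (W.baseChange K) ((2 : ℕ) : ℤ)),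
      u ≠ 0 ∧ g • u = u ∧ g • w ≠ w := by
  haveI : (W.baseChange K).IsElliptic := by rw [baseChange]; infer_instance
  have hΔK : ¬ IsSquare (W.baseChange K).Δ := by
    have : (W.baseChange K).Δ = algebraMap ℚ K W.Δ := by
      rw [baseChange, map_Δ]
    rw [this]
    exact not_isSquare_algebraMap_Δ_of_cmInert_two_of_heegner W hCM hin hsurj K hK hH
  exact exists_transposition_of_not_isSquare_Δ (W.baseChange K) hΔK

/-- **THE COMMUTANT OF `E(K̄)[2]` IS `𝔽₂` ON H₂, hypothesis-free**: for `W/ℚ` globally minimal with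
CM, `CMInert W 2`, `ρ̄_{W,2}` onto, and every imaginary quadratic `K` satisfying the Heegner
hypothesis for `N_E`, a `Γ_K`-equivariant additive endomorphism of `E(K̄)[2]` is `0` or the
identity (the transposition hypothesis of `eq_zero_or_eq_id_of_commute_two_of_hasSurjectiveModNGaloisRep`
discharged by `exists_transposition_of_cmInert_two_of_heegner`). The `p = 2` form of Gross's
*"`Hom_𝒢(Gal(L_S/L), E_p) ≃ (ℤ/p)^s`"* input on the habitat. [cite: GrossLMS1991, §9 (proof of Prop. 9.3)] -/
theorem eq_zero_or_eq_id_of_commute_two_of_cmInert_two_of_heegner [W.IsGloballyMinimal]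
    (hCM : W.HasCM) (hin : Literature.NumberTheory.EllipticCurves.Rank1Residual.CMInert W 2)
    (hsurj : W.HasSurjectiveModNGaloisRep 2) (K : Type) [Field K] [NumberField K]
    (hK : IsImaginaryQuadratic K) (hH : SatisfiesHeegnerHypothesis (W.conductorNorm ℤ) K)
    (f : geomTorsion (W.baseChange K) ((2 : ℕ) : ℤ) →+ geomTorsion (W.baseChange K) ((2 : ℕ) : ℤ))
    (hf : ∀ (g : absoluteGaloisGroup K) (t : geomTorsion (W.baseChange K) ((2 : ℕ) : ℤ)),
      f (g • t) = g • f t) :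
    (∀ t, f t = 0) ∨ (∀ t, f t = t) := by
  obtain ⟨τ, u, w, hu0, hu, hw⟩ := exists_transposition_of_cmInert_two_of_heegner W hCM hin hsurj K hK hH
  exact eq_zero_or_eq_id_of_commute_two_of_hasSurjectiveModNGaloisRep W K hK.1 hsurj hu hu0 hw f hf

end Quadratic

end Summit.BirchSwinnertonDyer.BirchSwinnertonDyer.Theorems.KolyvaginImageTwo

end
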